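import Mathlib
import HarnessLib
import Literature.Analysis.FluidPDE.PineauVicolOneSliceRegularityHolds
import Literature.Analysis.FluidPDE.ParasiticSlabFlow
import Literature.Analysis.FluidPDE.FlatSwirlGauge
import Literature.Analysis.FluidPDE.SteadyLiouvilleTsaiPressure
import Summits.NavierStokesRegularity.NavierStokesRegularity.Theses.LocalPressureProfileDoor
import Summits.NavierStokesRegularity.NavierStokesRegularity.Theorems.RellichScarScarRigidityApexRegularity
import Summits.NavierStokesRegularity.NavierStokesRegularity.Theorems.RellichScarSymmetricScarExistsOneSliceCriterion
import Summits.NavierStokesRegularity.NavierStokesRegularity.Theorems.SymmetryModuliCountFarPastLedgerReduction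
import Summits.NavierStokesRegularity.NavierStokesRegularity.Theorems.PoloidalWindowDoorPoloidalWindowRigidityWindow

/-!
# Route `LocalPressureProfileDoor`, crux K2⁺ `MonotonePressureProfileRigidity` (stmt-NavierStokesRegularity-20180),
# line `birth`: the stub `stub_regularOfSmallSlices` — ONE small-vorticity slice of a door-class profile makes the
# apex regular (Pineau–Vicol 2026, Lemma 9.4 + §9.2, replayed on the whole past)

Cell ns-regularity-ideate, seat ns-pressure-K2-p1 (LEAD on the crux; registered stub of the skeleton `Lines/birth.lean`,
sha 86b6bcf2…, signature VERBATIM; lands `--supports stmt-NavierStokesRegularity-20180`).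

**Statement (the stub).**  Let `v` be a profile of the door class — Type I in time, space–time Type-I decay
`‖v(t,x)‖ ≤ D/(‖x‖+√(−t))`, continuous on the open backward slab, unit-viscosity Oseen–Duhamel identity between
negative times, divergence-free slices — such that for every radius factor `R > 0` and every `θ > 0` some slice
`t̄ < 0` is `θ`-small in Pineau–Vicol's normalisation (9.17), `∫_{B(2R√(−t̄))} ‖curl v(t̄)‖² ≤ θ²/(4√(−t̄))`.
Then `v` is not backward-singular at the apex `(0,0)`.

**Proof.**  Pineau–Vicol's Theorem 1.9 (arXiv:2607.09619, §9.2, pp. 33–35) with its §9.3 input (the one-slice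
smallness derived from (1.17)) REPLACED by the hypothesis: `regular_of_smallSlice_region` (Lemma 9.4
`pineauVicol_smallVorticity_propagation`, (9.15)–(9.16) `exists_cknE_le_of_core_small`, Lemma 9.2 / Cor. 9.3, Prop. 9.5 +
CKN `pineauVicol_regular_of_zoom_small` — the assembly `pineauVicol2026_oneSlice_regularity_of_core'` verbatim);
`regular_of_smallSlice_class` (the Type-I ancient mild class is classical on the whole past WITH ITS RIESZ PRESSURE,
`RellichScarScarRigidity.isClassicalNSSolutionOn_rieszPressure`, which obeys `(‖x‖+√(−t))²|Q| ≤ K(D)`,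
`stub_apexRegPressureBounds`: (1.15) with `C_u = max D 0 + 1`, (1.16) with `C_p = 4K + 1`);
`setLIntegral_curl_sq_nsRescale_le` + the tree's `isTypeIAncientMild_nsRescale` (the slice functional, the class and the
singular apex are invariant under `v ↦ c v(c²·, c·)`, which moves any slice time into `(−T₀, 0)`);
`stub_regularOfSmallSlices` — the registered stub; the door class enters the Type-I ancient mild class by
`isTypeIAncientMild_of_class` — THIS is where the Oseen–Duhamel identity `hmild` is consumed (the refuter's
certificate `…Negative.stub_regularOfSmallSlices_false_without_mild`, p518176, shows it must be).

WHAT THIS IS NOT: not a claim about Navier–Stokes regularity and not the crux K2⁺ — the M-sized plumbing stub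
of line `birth` (bears_on LADDER-NS N0, rung N0-LocalTubeDoorPressureProfile).
-/

noncomputable section

set_option linter.dupNamespace false -- the summit and its sub-problem share the name (CONVENTIONS §1)
set_option maxSynthPendingDepth 3 -- nested operator types `ℝ³ →L[ℝ] ℝ³ →L[ℝ] ℝ³`

namespace Summit.NavierStokesRegularity.NavierStokesRegularity.Theorems.LocalPressureProfileDoorMonotonePressureProfileRigidityRegularOfSmallSlices

open MeasureTheory Set Function Filter Metric TopologicalSpace Topology
open scoped ENNReal NNReal InnerProductSpace RealInnerProductSpace Pointwise
open Literature.Analysis Literature.Analysis.FluidPDE Literature.Analysis.UnboundedOperators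
open Summit.NavierStokesRegularity.NavierStokesRegularity.Theorems.RellichScarScarRigidity
  (exists_isClassicalNSSolutionOn_Iio isClassicalNSSolutionOn_rieszPressure stub_apexRegPressureBounds)
open Summit.NavierStokesRegularity.NavierStokesRegularity.Theorems.SymmetricScarExists.LogtimeBernoulli
  (not_isBackwardSingularPoint_of_bound isClassicalNSSolutionOnRegion_pineauVicol_of_Iio)
open Summit.NavierStokesRegularity.NavierStokesRegularity.Theorems.PoloidalWindowDoorPoloidalWindowRigidityWindow
  (isTypeIAncientMild_of_class)

/-! ### Pineau–Vicol's §9.2 with the small slice as a hypothesis -/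

set_option maxHeartbeats 800000 in
/-- **Theorem 1.9 of Pineau–Vicol with the one-slice smallness of the VORTICITY as the hypothesis** (the printed
§9.2, pp. 33–35, without §9.3).  For `C_u, C_p > 0` there are `R, θ, T₀ > 0` such that: if `(u, p)` is a classical
solution of Navier–Stokes (`ν = 1`, `f = 0`) on `[−1,0) × B₁` with the Type I bound `‖u(t,x)‖ ≤ C_u/(√(−t)+‖x‖)`
(1.15) and `|p(t,x)| ≤ C_p` for `½ < ‖x‖ < ¾` (1.16), and if at some `t̄ ∈ (−T₀, 0)`
`∫_{B(2R√(−t̄))} ‖curl u(t̄)‖² ≤ θ²/(4√(−t̄))` (the normalisation (9.17)), then `u` is bounded on some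
`B_r × (−r², 0)`.  The constants: `θ = min(ϑ, √(ε/20))` (`ϑ` of Lemma 9.4, `ε` of the CKN criterion),
`R = max(R₀, 4JK²/θ²)`, `T₀ = T₀(R, c₁)` with the scale `c₁ = c₁(C_u, C_p)` of the gradient bounds of Lemma 9.2 /
Cor. 9.3; then Lemma 9.4 gives the small core dissipation on `[t̄, 0)`, (9.15)–(9.16) give `E(r; u) ≤ 10θ² < ε`
for `r ≤ min(√(−t̄), c₁/2, 1/32)`, and Prop. 9.5 concludes.
[cite: PineauVicol2026, §9.2 (proof of Theorem 1.9), Lemma 9.4, (9.15)–(9.16), Prop. 9.5, arXiv:2607.09619 pp. 31–35] -/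
theorem regular_of_smallSlice_region :
    ∀ Cu : ℝ, 0 < Cu → ∀ Cp : ℝ, 0 < Cp → ∃ R θ T₀ : ℝ, 0 < R ∧ 0 < θ ∧ 0 < T₀ ∧
    ∀ (u : ℝ → EuclideanSpace ℝ (Fin 3) → EuclideanSpace ℝ (Fin 3))
      (p : ℝ → EuclideanSpace ℝ (Fin 3) → ℝ),
      IsClassicalNSSolutionOnRegion
        (Ico (-1 : ℝ) 0 ×ˢ ball (0 : EuclideanSpace ℝ (Fin 3)) 1) 1 0 u p →
      (∀ t ∈ Ico (-1 : ℝ) 0, ∀ x ∈ ball (0 : EuclideanSpace ℝ (Fin 3)) 1,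
        ‖u t x‖ ≤ Cu / (Real.sqrt (-t) + ‖x‖)) →
      (∀ t ∈ Ico (-1 : ℝ) 0, ∀ x : EuclideanSpace ℝ (Fin 3),
        1 / 2 < ‖x‖ → ‖x‖ < 3 / 4 → |p t x| ≤ Cp) →
      ∀ tb ∈ Ioo (-T₀) 0,
        (∫⁻ x in ball (0 : EuclideanSpace ℝ (Fin 3)) (2 * R * Real.sqrt (-tb)),
            ENNReal.ofReal (‖curl (u tb) x‖ ^ 2) ≤
          ENNReal.ofReal (θ ^ 2 / (4 * Real.sqrt (-tb)))) →
        ∃ r : ℝ, 0 < r ∧ ∃ M : ℝ, ∀ t : ℝ, -r ^ 2 < t → t < 0 →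
          ∀ x ∈ ball (0 : EuclideanSpace ℝ (Fin 3)) r, ‖u t x‖ ≤ M := by
  intro Cu hCu Cp hCp
  -- universal constants
  obtain ⟨ε, hε, Hzoom⟩ := pineauVicol_regular_of_zoom_small
  obtain ⟨J, hJ, Hglue⟩ := exists_cknE_le_of_core_small
  obtain ⟨K, hK0, HK⟩ := exists_forall_fderiv_le_of_typeI_of_bounds Cu
  obtain ⟨K₂, -, HK₂⟩ := exists_forall_iteratedFDeriv_le_of_typeI_of_bounds 2 Cu
  obtain ⟨ϑ, hϑ, HA⟩ := pineauVicol_smallVorticity_propagation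
  -- `θ` with `10 θ² < ε`, `θ ≤ ϑ`
  set θ : ℝ := min ϑ (Real.sqrt (ε / 20)) with hθ_def
  have hθ0 : 0 < θ := lt_min hϑ (Real.sqrt_pos.2 (by positivity))
  have hθϑ : θ ≤ ϑ := min_le_left _ _
  have hθε : 10 * θ ^ 2 < ε := by
    have h1 : θ ≤ Real.sqrt (ε / 20) := min_le_right _ _
    have h2 : θ ^ 2 ≤ ε / 20 := by
      calc θ ^ 2 ≤ (Real.sqrt (ε / 20)) ^ 2 := pow_le_pow_left₀ hθ0.le h1 2
        _ = ε / 20 := Real.sq_sqrt (by positivity)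
    linarith
  obtain ⟨R₀, hR₀2, HA'⟩ := HA θ hθ0 hθϑ Cu K K₂
  -- `R` with `J K² / (R/2) ≤ θ²`
  set R : ℝ := max R₀ (4 * J * K ^ 2 / θ ^ 2) with hR_def
  have hRR₀ : R₀ ≤ R := le_max_left _ _
  have hR2 : 2 ≤ R := hR₀2.trans hRR₀
  have hR0 : 0 < R := by linarith
  have hJR : J * K ^ 2 / (R / 2) ≤ θ ^ 2 := by
    have h1 : 4 * J * K ^ 2 / θ ^ 2 ≤ R := le_max_right _ _
    rw [div_le_iff₀ (by positivity)]
    rw [div_le_iff₀ (by positivity)] at h1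
    nlinarith
  -- the global bounds `Bu(Cu)`, `Bp(Cu, Cp)` and the scale `c₁`
  obtain ⟨Bp, HBp⟩ := exists_lintegral_pressure_rpow_threeHalves_le Cu Cp
  set Tq : ℝ≥0∞ := ∫⁻ t in Ioo (-1 : ℝ) 0, ENNReal.ofReal ((-t) ^ (-(1 / 4 : ℝ))) with hTq
  set Xq : ℝ≥0∞ := ∫⁻ x in ball (0 : EuclideanSpace ℝ (Fin 3)) 1,
    ENNReal.ofReal (‖x‖ ^ (-(5 / 2 : ℝ))) with hXq
  set Bu : ℝ≥0∞ := ENNReal.ofReal (Cu ^ 3) * (Tq * Xq) with hBu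
  have hBut : Bu < ⊤ := ENNReal.mul_lt_top ENNReal.ofReal_lt_top
    (ENNReal.mul_lt_top lintegral_Ioo_neg_rpow_quarter_lt_top lintegral_ball_norm_rpow_lt_top)
  obtain ⟨c₁', hc₁', Hgrad'⟩ := HK Bu Bp hBut ENNReal.coe_lt_top
  obtain ⟨c₂, hc₂, Hgrad2⟩ := HK₂ Bu Bp hBut ENNReal.coe_lt_top
  set c₁ : ℝ := min c₁' c₂ with hc₁_def
  have hc₁ : 0 < c₁ := lt_min hc₁' hc₂
  obtain ⟨T₀, hT₀, hT₀1, HA''⟩ := HA' R hRR₀ c₁ hc₁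
  refine ⟨R, θ, T₀, hR0, hθ0, hT₀, fun u p hreg hI hP tb htb hcurl => ?_⟩
  have htb0 : tb < 0 := htb.2
  have htbT : -T₀ < tb := htb.1
  have htbm1 : -1 < tb := by linarith
  have hsq : 0 < Real.sqrt (-tb) := Real.sqrt_pos.2 (by linarith)
  -- the bounds of this solution
  have hBu_u : ∫⁻ w in Ioo (-1 : ℝ) 0 ×ˢ ball (0 : EuclideanSpace ℝ (Fin 3)) 1,
      ‖u w.1 w.2‖ₑ ^ (3 : ℕ) ≤ Bu := by
    refine le_trans (le_of_eq (lintegral_congr fun w => ?_)) (lintegral_typeI_cube_le hI)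
    rw [← ofReal_norm, ENNReal.ofReal_pow (norm_nonneg _)]
  have hgradu : ∀ t ∈ Ioo (-1 : ℝ) 0, ∀ x : EuclideanSpace ℝ (Fin 3), ‖x‖ + Real.sqrt (-t) ≤ c₁ →
      ‖fderiv ℝ (u t) x‖ ≤ K / (‖x‖ + Real.sqrt (-t)) ^ 2 := fun t ht x hx =>
    Hgrad' u p hreg hI hBu_u (HBp u p hreg hI hP) t ht x (hx.trans (min_le_left _ _))
  have hgrad2u : ∀ t ∈ Ioo (-1 : ℝ) 0, ∀ x : EuclideanSpace ℝ (Fin 3), ‖x‖ + Real.sqrt (-t) ≤ c₁ →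
      ‖iteratedFDeriv ℝ 2 (u t) x‖ ≤ K₂ / (‖x‖ + Real.sqrt (-t)) ^ 3 := fun t ht x hx =>
    Hgrad2 u p hreg hI hBu_u (HBp u p hreg hI hP) t ht x (hx.trans (min_le_right _ _))
  -- Lemma 9.4: the small core
  have hcore := HA'' u p hreg hI hgradu hgrad2u tb htb hcurl
  -- (9.15)–(9.16): `E(r; u) ≤ 10 θ²` for `r ≤ r₀`
  have hO : IsOpen (Ioo (-1 : ℝ) 0 ×ˢ ball (0 : EuclideanSpace ℝ (Fin 3)) 1) :=
    isOpen_Ioo.prod isOpen_ball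
  have hreg' := hreg.mono_of_isOpen (prod_mono Ioo_subset_Ico_self Subset.rfl) hO
  have hcont : ContinuousOn (fun w : ℝ × EuclideanSpace ℝ (Fin 3) => fderiv ℝ (u w.1) w.2)
      (Ioo (-1 : ℝ) 0 ×ˢ ball (0 : EuclideanSpace ℝ (Fin 3)) 1) :=
    continuousOn_fderiv_slice_of_isOpen hO hreg'.smooth_velocity (by exact_mod_cast le_top)
  have hcore' : ∀ t ∈ Ioo (-(-tb)) 0,
      ∫⁻ x in ball (0 : EuclideanSpace ℝ (Fin 3)) (R / 2 * Real.sqrt (-t)),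
          ENNReal.ofReal (frobeniusNormSq (fderiv ℝ (u t) x)) ≤
        ENNReal.ofReal (4 * θ ^ 2 / Real.sqrt (-t)) := by
    intro t ht
    exact hcore t ⟨by linarith [ht.1], ht.2⟩
  have hE : ∀ r : ℝ, 0 < r → r ≤ Real.sqrt (-tb) → r ≤ c₁ / 2 → r ≤ 1 →
      cknE r (0 : ℝ × EuclideanSpace ℝ (Fin 3)) (fun t x => fderiv ℝ (u t) x) ≤
        ENNReal.ofReal (10 * θ ^ 2) :=
    Hglue u θ K c₁ (R / 2) (-tb) hθ0 hK0 hc₁ (by positivity) (by linarith) hcont hcore' hgradu hJR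
  -- the zoom factor
  set c : ℝ := min (min (Real.sqrt (-tb)) (c₁ / 2)) (1 / 32) with hc_def
  have hc0 : 0 < c := lt_min (lt_min hsq (by positivity)) (by norm_num)
  have hc32 : c ≤ 1 / 32 := min_le_right _ _
  have hcsq : c ≤ Real.sqrt (-tb) := (min_le_left _ _).trans (min_le_left _ _)
  have hcc₁ : c ≤ c₁ / 2 := (min_le_left _ _).trans (min_le_right _ _)
  have hsup : (⨆ r ∈ Ioo (0 : ℝ) 1,
      cknE r (0 : ℝ × EuclideanSpace ℝ (Fin 3)) (fun t x => fderiv ℝ (nsRescale c u t) x)) <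
        ENNReal.ofReal ε := by
    refine lt_of_le_of_lt (iSup₂_le fun r hr => ?_) ((ENNReal.ofReal_lt_ofReal_iff hε).2 hθε)
    have h3 : stAffine (c ^ 2) c 0 (0 : EuclideanSpace ℝ (Fin 3)) (0 : ℝ × EuclideanSpace ℝ (Fin 3)) = 0 := by
      simp [stAffine]
    rw [fderiv_nsRescale_eq_smul_stPull, cknE_nsZoom hc0 hr.1 0 0 0, h3]
    refine hE (c * r) (mul_pos hc0 hr.1) ?_ ?_ ?_
    · calc c * r ≤ c * 1 := by gcongr; exact hr.2.le
        _ ≤ Real.sqrt (-tb) := by rw [mul_one]; exact hcsq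
    · calc c * r ≤ c * 1 := by gcongr; exact hr.2.le
        _ ≤ c₁ / 2 := by rw [mul_one]; exact hcc₁
    · calc c * r ≤ c * 1 := by gcongr; exact hr.2.le
        _ ≤ 1 := by rw [mul_one]; linarith
  exact Hzoom u p Cu Cp c hreg hI hP hc0 hc32 hsup

/-! ### The Type-I ancient mild class: ONE small slice near the apex gives a regular apex -/

/-- **For the tree's Type-I ancient mild class with the space–time Type-I bound, one small slice NEAR the apex
settles regularity.**  For every `D` there are `R, θ, T₀ > 0` (depending on `D` only) such that every `v` with
`IsTypeIAncientMild D v` and `HasTypeIDecay D v` having a `(9.17)`-slice `∫_{B(2R√(−t̄))} ‖curl v(t̄)‖² ≤ θ²/(4√(−t̄))`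
at some `t̄ ∈ (−T₀, 0)` is NOT backward-singular at `(0,0)`.  The field is classical on the whole past with its
Riesz pressure (`isClassicalNSSolutionOn_rieszPressure`: the jointly smooth Calderón–Zygmund pressure), which obeys
`(‖x‖+√(−t))² |Q[v(t)](x)| ≤ K(D)` (`stub_apexRegPressureBounds`), so on `[−1,0) × B₁` (1.15) holds with
`C_u = max D 0 + 1` and (1.16) with `C_p = 4K + 1`; `regular_of_smallSlice_region` and
`not_isBackwardSingularPoint_of_bound` conclude. [cite: PineauVicol2026, Theorem 1.9 and footnote 12, arXiv:2607.09619 p. 8] -/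
theorem regular_of_smallSlice_class (D : ℝ) : ∃ R θ T₀ : ℝ, 0 < R ∧ 0 < θ ∧ 0 < T₀ ∧
    ∀ (v : ℝ → EuclideanSpace ℝ (Fin 3) → EuclideanSpace ℝ (Fin 3)),
      IsTypeIAncientMild D v → HasTypeIDecay D v →
      ∀ tb ∈ Ioo (-T₀) 0,
        (∫⁻ x in ball (0 : EuclideanSpace ℝ (Fin 3)) (2 * R * Real.sqrt (-tb)),
            ENNReal.ofReal (‖curl (v tb) x‖ ^ 2) ≤
          ENNReal.ofReal (θ ^ 2 / (4 * Real.sqrt (-tb)))) →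
        ¬ IsBackwardSingularPoint v 0 := by
  obtain ⟨Kp, hKp0, hKp⟩ := stub_apexRegPressureBounds 0 D
  set Cu : ℝ := max D 0 + 1 with hCu_def
  have hCu : 0 < Cu := by rw [hCu_def]; positivity
  set Cp : ℝ := 4 * Kp + 1 with hCp_def
  have hCp : 0 < Cp := by rw [hCp_def]; positivity
  obtain ⟨R, θ, T₀, hR, hθ, hT₀, H⟩ := regular_of_smallSlice_region Cu hCu Cp hCp
  refine ⟨R, θ, T₀, hR, hθ, hT₀, fun v hA hdec tb htb hsl => ?_⟩
  -- classical on the whole past with the Riesz pressure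
  obtain ⟨q, hq⟩ := exists_isClassicalNSSolutionOn_Iio hA
  have hcl := isClassicalNSSolutionOn_rieszPressure hq hdec
  have hreg := isClassicalNSSolutionOnRegion_pineauVicol_of_Iio hcl
  -- (1.15)
  have hI : ∀ t ∈ Ico (-1 : ℝ) 0, ∀ x ∈ ball (0 : EuclideanSpace ℝ (Fin 3)) 1,
      ‖v t x‖ ≤ Cu / (Real.sqrt (-t) + ‖x‖) := by
    intro t ht x _
    have h1 := hdec t ht.2 x
    have hpos : 0 < ‖x‖ + Real.sqrt (-t) := by
      have : 0 < Real.sqrt (-t) := Real.sqrt_pos.2 (by linarith [ht.2])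
      positivity
    rw [add_comm (Real.sqrt (-t))]
    refine h1.trans (div_le_div_of_nonneg_right ?_ hpos.le)
    rw [hCu_def]
    linarith [le_max_left D 0]
  -- (1.16) for the Riesz pressure
  have hP : ∀ t ∈ Ico (-1 : ℝ) 0, ∀ x : EuclideanSpace ℝ (Fin 3), 1 / 2 < ‖x‖ → ‖x‖ < 3 / 4 →
      |pressurePotential (v t) x| ≤ Cp := by
    intro t ht x hx1 _
    have h1 := hKp v q hq hdec t ht.2 x
    rw [norm_iteratedFDeriv_zero, Real.norm_eq_abs, zero_add] at h1
    have hs0 : 0 ≤ Real.sqrt (-t) := Real.sqrt_nonneg _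
    have hw : (1 / 4 : ℝ) ≤ (‖x‖ + Real.sqrt (-t)) ^ 2 := by nlinarith [norm_nonneg x]
    have habs : 0 ≤ |pressurePotential (v t) x| := abs_nonneg _
    have h2 : (1 / 4 : ℝ) * |pressurePotential (v t) x| ≤ Kp :=
      (mul_le_mul_of_nonneg_right hw habs).trans h1
    rw [hCp_def]
    linarith
  obtain ⟨r, hr, M, hM⟩ := H v (fun t x => pressurePotential (v t) x) hreg hI hP tb htb hsl
  exact not_isBackwardSingularPoint_of_bound hr hM

/-! ### Scale invariance of the slice functional (9.17) -/

/-- **The slice functional (9.17) is invariant under the Navier–Stokes scaling.**  For `c > 0` and `t̄ < 0`, the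
rescaled field `v_c(t,x) = c v(c²t, cx)` (`nsRescale c v`) at the time `t̄/c²` has
`∫_{B(2R√(−t̄/c²))} ‖curl v_c(t̄/c²)‖² = c ∫_{B(2R√(−t̄))} ‖curl v(t̄)‖²` (chain rule `curl(c v(c·)) = c²(curl v)(c·)`
and the change of variables `x ↦ cx`), while `θ²/(4√(−t̄/c²)) = c · θ²/(4√(−t̄))`; so the smallness of the slice
transports. [cite: PineauVicol2026, (9.17), arXiv:2607.09619 p. 33] -/
theorem setLIntegral_curl_sq_nsRescale_le {v : ℝ → EuclideanSpace ℝ (Fin 3) → EuclideanSpace ℝ (Fin 3)}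
    {c tb R θ : ℝ} (hc : 0 < c) (htb : tb < 0)
    (h : (∫⁻ x in ball (0 : EuclideanSpace ℝ (Fin 3)) (2 * R * Real.sqrt (-tb)),
        ENNReal.ofReal (‖curl (v tb) x‖ ^ 2)) ≤ ENNReal.ofReal (θ ^ 2 / (4 * Real.sqrt (-tb)))) :
    (∫⁻ x in ball (0 : EuclideanSpace ℝ (Fin 3)) (2 * R * Real.sqrt (-(tb / c ^ 2))),
        ENNReal.ofReal (‖curl (nsRescale c v (tb / c ^ 2)) x‖ ^ 2)) ≤
      ENNReal.ofReal (θ ^ 2 / (4 * Real.sqrt (-(tb / c ^ 2)))) := by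
  have hc0 : c ≠ 0 := hc.ne'
  have hsq0 : 0 < Real.sqrt (-tb) := Real.sqrt_pos.2 (by linarith)
  -- the rescaled slice and its curl
  have hslice : nsRescale c v (tb / c ^ 2) = fun x => c • v tb (c • x) := by
    funext x
    rw [nsRescale_apply, mul_div_cancel₀ _ (pow_ne_zero 2 hc0)]
  have hcurl : ∀ x, curl (nsRescale c v (tb / c ^ 2)) x = (c * c) • curl (v tb) (c • x) := fun x => by
    rw [hslice, curl_smul_comp_smul]
  -- the radii
  have hsqrt : Real.sqrt (-(tb / c ^ 2)) = Real.sqrt (-tb) / c := by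
    rw [show -(tb / c ^ 2) = -tb / c ^ 2 by ring, Real.sqrt_div' _ (sq_nonneg c), Real.sqrt_sq hc.le]
  have hrad : ball (0 : EuclideanSpace ℝ (Fin 3)) (2 * R * Real.sqrt (-tb)) =
      c • ball (0 : EuclideanSpace ℝ (Fin 3)) (2 * R * Real.sqrt (-(tb / c ^ 2))) := by
    rw [_root_.smul_ball hc0, smul_zero, Real.norm_of_nonneg hc.le, hsqrt]
    congr 1
    field_simp
  -- change of variables
  have hcv : (∫⁻ x in ball (0 : EuclideanSpace ℝ (Fin 3)) (2 * R * Real.sqrt (-(tb / c ^ 2))),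
      ENNReal.ofReal (‖curl (nsRescale c v (tb / c ^ 2)) x‖ ^ 2)) =
      ENNReal.ofReal c * ∫⁻ x in ball (0 : EuclideanSpace ℝ (Fin 3)) (2 * R * Real.sqrt (-tb)),
        ENNReal.ofReal (‖curl (v tb) x‖ ^ 2) := by
    have h1 : ∀ x, ENNReal.ofReal (‖curl (nsRescale c v (tb / c ^ 2)) x‖ ^ 2) =
        ENNReal.ofReal ((c * c) ^ 2) * ENNReal.ofReal (‖curl (v tb) (c • x)‖ ^ 2) := fun x => by
      rw [hcurl, norm_smul, mul_pow, Real.norm_of_nonneg (mul_self_nonneg c), ENNReal.ofReal_mul (sq_nonneg _)]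
    simp_rw [h1]
    rw [lintegral_const_mul' _ _ ENNReal.ofReal_ne_top,
      Tsai2021.lintegral_comp_smul_set (fun x => ENNReal.ofReal (‖curl (v tb) x‖ ^ 2)) hc measurableSet_ball,
      ← hrad, ← mul_assoc, ← ENNReal.ofReal_mul (sq_nonneg _)]
    congr 2
    rw [show (c * c) ^ 2 = c * c ^ 3 by ring, mul_inv_cancel_right₀ (pow_ne_zero 3 hc0)]
  rw [hcv, hsqrt]
  calc ENNReal.ofReal c * ∫⁻ x in ball (0 : EuclideanSpace ℝ (Fin 3)) (2 * R * Real.sqrt (-tb)),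
        ENNReal.ofReal (‖curl (v tb) x‖ ^ 2)
      ≤ ENNReal.ofReal c * ENNReal.ofReal (θ ^ 2 / (4 * Real.sqrt (-tb))) := by gcongr
    _ = ENNReal.ofReal (θ ^ 2 / (4 * (Real.sqrt (-tb) / c))) := by
        rw [← ENNReal.ofReal_mul hc.le]
        congr 1
        field_simp

/-! ### The registered stub -/

/-- **STUB `stub_regularOfSmallSlices` of line `birth` (crux K2⁺ `MonotonePressureProfileRigidity`,
stmt-NavierStokesRegularity-20180; signature verbatim).**  A door-class profile (Type I in time, space–time Type-I
decay, continuous on the open backward slab, unit-viscosity Oseen–Duhamel mild, divergence-free slices) that has,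
for every `R, θ > 0`, a slice `t̄ < 0` with `∫_{B(2R√(−t̄))} ‖curl v(t̄)‖² ≤ θ²/(4√(−t̄))`, is not
backward-singular at the apex.  Proof: the door class lies in the Type-I ancient mild class
(`isTypeIAncientMild_of_class` — the Oseen–Duhamel identity is consumed HERE, cf. the refuter's
`…Negative.stub_regularOfSmallSlices_false_without_mild`) with the constant `D` of the space–time bound
(`HasTypeIDecay.hasTypeITimeDecay`); take the `R, θ, T₀` of `regular_of_smallSlice_class D` and a slice `t̄ < 0` for
`(R, θ)`; the parabolic rescaling by `c = √(−t̄/T₀) + 1` moves the slice to `t̄/c² ∈ (−T₀, 0)`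
(`setLIntegral_curl_sq_nsRescale_le`) inside the same class with the same `D` (`isTypeIAncientMild_nsRescale`,
`HasTypeIDecay.nsRescale`), and the singularity of the apex is scale invariant (`isBackwardSingularPoint_nsRescale`).
[cite: PineauVicol2026, Theorem 1.9, Lemma 9.4, arXiv:2607.09619 pp. 8, 31–35] -/
theorem stub_regularOfSmallSlices :
    ∀ (C D : ℝ) (v : ℝ → EuclideanSpace ℝ (Fin 3) → EuclideanSpace ℝ (Fin 3)),
    Literature.Analysis.FluidPDE.HasTypeITimeDecay C v →
    Literature.Analysis.FluidPDE.HasTypeIDecay D v →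
    ContinuousOn (Function.uncurry v) (Set.Iio (0 : ℝ) ×ˢ Set.univ) →
    (∀ s t : ℝ, s < t → t < 0 → ∀ x, v t x =
      Literature.Analysis.UnboundedOperators.heatExtension (v s) (t - s) x -
        Literature.Analysis.FluidPDE.oseenDuhamel 1 s v v t x) →
    (∀ t < 0, Literature.Analysis.FluidPDE.VectorCalculus.IsDivFree (v t)) →
    (∀ R θ : ℝ, 0 < R → 0 < θ → ∃ tb : ℝ, tb < 0 ∧
      (∫⁻ x in Metric.ball (0 : EuclideanSpace ℝ (Fin 3)) (2 * R * Real.sqrt (-tb)),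
          ENNReal.ofReal (‖Literature.Analysis.FluidPDE.curl (v tb) x‖ ^ 2)) ≤
        ENNReal.ofReal (θ ^ 2 / (4 * Real.sqrt (-tb)))) →
    ¬ Literature.Analysis.FluidPDE.IsBackwardSingularPoint v 0 := by
  intro C D v _hrate hdecay hcont hmild hdiv hslices
  have hD0 : 0 ≤ D := nonneg_of_hasTypeIDecay hdecay
  -- the class membership at the space–time constant `D` (the Oseen–Duhamel identity is used here)
  have hA : IsTypeIAncientMild D v := isTypeIAncientMild_of_class (hdecay.hasTypeITimeDecay hD0) hcont hmild hdiv
  obtain ⟨R, θ, T₀, hR, hθ, hT₀, H⟩ := regular_of_smallSlice_class D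
  obtain ⟨tb, htb, hsl⟩ := hslices R θ hR hθ
  -- the rescaling factor
  set c : ℝ := Real.sqrt (-tb / T₀) + 1 with hc_def
  have hc : 0 < c := by rw [hc_def]; positivity
  have hc1 : -tb / T₀ < c ^ 2 := by
    have h0 : 0 ≤ -tb / T₀ := div_nonneg (by linarith) hT₀.le
    have h1 : Real.sqrt (-tb / T₀) < c := by rw [hc_def]; linarith
    calc -tb / T₀ = (Real.sqrt (-tb / T₀)) ^ 2 := (Real.sq_sqrt h0).symm
      _ < c ^ 2 := pow_lt_pow_left₀ h1 (Real.sqrt_nonneg _) two_ne_zero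
  have htb' : tb / c ^ 2 ∈ Ioo (-T₀) 0 := by
    have hc2 : 0 < c ^ 2 := pow_pos hc 2
    refine ⟨?_, div_neg_of_neg_of_pos htb hc2⟩
    rw [div_lt_iff₀ hT₀] at hc1
    rw [lt_div_iff₀ hc2]
    linarith
  intro hsing
  exact H (nsRescale c v) (isTypeIAncientMild_nsRescale hA hc) (hdecay.nsRescale hc) (tb / c ^ 2) htb'
    (setLIntegral_curl_sq_nsRescale_le hc htb hsl)
    (SymmetricScarExists.LogtimeBernoulli.isBackwardSingularPoint_nsRescale hc hsing)

end Summit.NavierStokesRegularity.NavierStokesRegularity.Theorems.LocalPressureProfileDoorMonotonePressureProfileRigidityRegularOfSmallSlices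

end
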